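import Mathlib.NumberTheory.Chebyshev
import Mathlib.Data.Nat.Choose.Factorization
import Mathlib.Data.Nat.Choose.Central
import Mathlib.Tactic
import HarnessLib

/-!
# Calegari–Dimitrov–Tang, Lemma "bdenominators" (§10.2): the denominator types of the pure
functions `B₂, B₃, B₅, B₆` on `P¹ ∖ {0, 4, ∞}`

Proof-side sibling of `CalegariDimitrovTangL2Chi3.lean` (named fact
`Literature.NumberTheory.Transcendental.calegariDimitrovTang_linearIndependent`, CDT 2024
Thm. 1). Step 3 of the printed proof of Thm. 1 (§13, p. 106) feeds the holonomy bound with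
`m = 14` functions `B₁, …, B₇, G, G′, …` whose *denominator types* (eq. (integrality), §2.2)
enter the rate `τ♭(b) = 191/49`; "the denominator types were computed in Lemma
(bdenominators)". That lemma (§10.2, p. 98) reads: `B₁` trivial; `B₂` type `[1,…,2n]`;
`B₃` type `[1,…,2n]·n`; `B₄` type `[1,…,2n]²`; `B₅` type `[1,…,2n]·(2n−1)`; `B₆` type
`[1,…,2n]·n²`; `B₇` type `[1,…,2n]²·n` — "for the remainder [`B₂,B₃,B₅,B₆`], it follows by
direct computation since there is an explicit expression in terms of factorials for the general
coefficient", the coefficients being (§10.1 eq. (defB), (defB5); §10.2 eq. (defB67), pp. 97–98)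
`B₂ = Σ_{n≥2} 2yⁿ(n−2)!n!/(2n)!`, `B₃ = Σ_{n≥1} yⁿ(n−1)!²/(2n)!`,
`B₅ = Σ_{n≥1} yⁿ(n−1)!²/((2n−1)!(2n−1))`, `B₆ = Σ_{n≥1} yⁿ(n−1)!²/(n(2n)!)`.

This file PROVES those four "direct computations" (a function `Σ aₙyⁿ/Dₙ`, `aₙ ∈ ℤ`, has
denominator type `Dₙ` when `Dₙ · (coefficient) ∈ ℤ`; we state each as a divisibility in `ℕ`):

* `CalegariDimitrovTang.factorial_two_mul_dvd_lcmUpto_mul_two_mul` — `B₂`: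
  `(2n)! ∣ lcm(1,…,2n) · 2(n−2)! n!` (`n ≥ 2`);
* `CalegariDimitrovTang.factorial_two_mul_dvd_lcmUpto_mul` — `B₃`:
  `(2n)! ∣ lcm(1,…,2n) · n · (n−1)!²` (`n ≥ 1`);
* `CalegariDimitrovTang.factorial_two_mul_sub_one_dvd_lcmUpto_mul` — `B₅`:
  `(2n−1)!(2n−1) ∣ lcm(1,…,2n) · (2n−1) · (n−1)!²`;
* `CalegariDimitrovTang.mul_factorial_two_mul_dvd_lcmUpto_mul` — `B₆`:
  `n(2n)! ∣ lcm(1,…,2n) · n² · (n−1)!²`;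

all reduced to the two arithmetic facts `n·C(2n,n) ∣ lcm(1,…,2n)`
(`mul_centralBinom_dvd_lcmUpto`) and `n(n−1)·C(2n,n) ∣ 2·lcm(1,…,2n)`
(`mul_sub_one_mul_centralBinom_dvd_two_mul_lcmUpto`), proved prime by prime with Kummer's
carry count for `C(2n,n)` (Mathlib `Nat.factorization_choose'`) refined above the `p`-part of
`n` resp. `n − 1` (`factorization_centralBinom_le_card_add`), against
`v_p(lcm(1,…,N)) = ⌊log_p N⌋` (Mathlib `Nat.factorization_lcmUpto`, `Nat.lcmUpto`).

Not here: `B₄` and `B₇` (their types come from the symmetrisation Lemma "etalecover" of §9, not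
from a closed formula), the finer Remark 118 (`[1,…,2n]` relaxable to `n(n−1)C(2n,n)`), and the
identification of the coefficient formulas with the closed forms `2 arcsin(√y/2)²` etc.
No named facts (D-0026); Mathlib-only imports.

## References

* [CalegariDimitrovTang2024] F. Calegari, V. Dimitrov, Y. Tang, arXiv:2408.15403 — §10.1
  eqs. (defB), (defB5) (p. 97), §10.2 eq. (defB67) and Lemma "bdenominators" (p. 98), §13 (p. 106).
-/

open Nat Finset

namespace Literature.NumberTheory.Transcendental

namespace CalegariDimitrovTang

/-! ### Kummer's count for the central binomial coefficient, above the `p`-part of `n` -/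

/-- **Kummer, refined for `C(2n, n)`.** For any `a`, `v_p(C(2n,n))` — the number of carries when
`n` is added to itself in base `p` (`Nat.factorization_choose'`) — is at most the number of
carrying positions `i ≤ a` (those with `p^i ≤ 2 (n mod p^i)`) plus `⌊log_p 2n⌋ − a` (all
positions `a < i ≤ ⌊log_p 2n⌋`). [folklore] -/
theorem factorization_centralBinom_le_card_add {p n : ℕ} (a : ℕ) (hp : p.Prime) :
    ((2 * n).choose n).factorization p ≤
      ((Finset.Icc 1 a).filter (fun i => p ^ i ≤ n % p ^ i + n % p ^ i)).card
        + (Nat.log p (2 * n) - a) := by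
  rw [two_mul, Nat.factorization_choose' hp (lt_succ_self (Nat.log p (n + n)))]
  have hsub : (Finset.Ico 1 (Nat.log p (n + n) + 1)).filter
      (fun i => p ^ i ≤ n % p ^ i + n % p ^ i) ⊆
        (Finset.Icc 1 a).filter (fun i => p ^ i ≤ n % p ^ i + n % p ^ i)
          ∪ Finset.Ioc a (Nat.log p (n + n)) := by
    intro i hi
    rw [Finset.mem_filter, Finset.mem_Ico] at hi
    obtain ⟨⟨hi1, _⟩, hcarry⟩ := hi
    rw [Finset.mem_union, Finset.mem_filter, Finset.mem_Icc, Finset.mem_Ioc]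
    rcases le_or_gt i a with hia | hia
    · exact Or.inl ⟨⟨hi1, hia⟩, hcarry⟩
    · refine Or.inr ⟨hia, ?_⟩
      refine Nat.le_log_of_pow_le hp.one_lt (hcarry.trans ?_)
      exact Nat.add_le_add (Nat.mod_le _ _) (Nat.mod_le _ _)
  calc ((Finset.Ico 1 (Nat.log p (n + n) + 1)).filter
        (fun i => p ^ i ≤ n % p ^ i + n % p ^ i)).card
      ≤ ((Finset.Icc 1 a).filter (fun i => p ^ i ≤ n % p ^ i + n % p ^ i)
          ∪ Finset.Ioc a (Nat.log p (n + n))).card := Finset.card_le_card hsub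
    _ ≤ ((Finset.Icc 1 a).filter (fun i => p ^ i ≤ n % p ^ i + n % p ^ i)).card
          + (Finset.Ioc a (Nat.log p (n + n))).card := Finset.card_union_le _ _
    _ = _ := by rw [Nat.card_Ioc]

/-- Special case: if none of the first `a` positions carries, `v_p(C(2n,n)) ≤ ⌊log_p 2n⌋ − a`.
[folklore] -/
theorem factorization_centralBinom_le_log_sub {p n a : ℕ} (hp : p.Prime)
    (ha : ∀ i ∈ Finset.Icc 1 a, ¬ p ^ i ≤ n % p ^ i + n % p ^ i) :
    ((2 * n).choose n).factorization p ≤ Nat.log p (2 * n) - a := by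
  have h := factorization_centralBinom_le_card_add a hp (n := n)
  rwa [Finset.filter_eq_empty_iff.mpr ha, Finset.card_empty, zero_add] at h

/-- **`v_p(n) + v_p(C(2n,n)) ≤ ⌊log_p(2n)⌋`** for `n ≥ 1`: adding `n` to itself in base `p`
produces no carry in the `v_p(n)` trailing zero digits. [folklore] -/
theorem factorization_add_factorization_centralBinom_le_log {p n : ℕ} (hp : p.Prime)
    (hn : n ≠ 0) :
    n.factorization p + ((2 * n).choose n).factorization p ≤ Nat.log p (2 * n) := by
  set a := n.factorization p with ha_def
  have hpa : p ^ a ∣ n := Nat.ordProj_dvd n p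
  have haL : a ≤ Nat.log p (2 * n) := by
    refine Nat.le_log_of_pow_le hp.one_lt ?_
    exact (Nat.le_of_dvd (Nat.pos_of_ne_zero hn) hpa).trans (Nat.le_mul_of_pos_left n two_pos)
  have hcarry : ∀ i ∈ Finset.Icc 1 a, ¬ p ^ i ≤ n % p ^ i + n % p ^ i := by
    intro i hi hle
    have hdvd : p ^ i ∣ n := (Nat.pow_dvd_pow p (Finset.mem_Icc.mp hi).2).trans hpa
    rw [Nat.mod_eq_zero_of_dvd hdvd, add_zero] at hle
    exact absurd hle (not_le.mpr (pow_pos hp.pos i))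
  have h := factorization_centralBinom_le_log_sub hp hcarry
  omega

/-- **`n · C(2n, n)` divides `lcm(1, …, 2n)`** (`n ≥ 1`): prime by prime,
`v_p(n·C(2n,n)) ≤ ⌊log_p 2n⌋ = v_p(lcm(1,…,2n))` (`Nat.factorization_lcmUpto`). This is the
arithmetic content of the denominator types of `B₃, B₅, B₆` in CDT's Lemma "bdenominators".
[folklore] -/
theorem mul_centralBinom_dvd_lcmUpto {n : ℕ} (hn : n ≠ 0) :
    n * (2 * n).choose n ∣ Nat.lcmUpto (2 * n) := by
  have hC : (2 * n).choose n ≠ 0 := (Nat.choose_pos (by omega)).ne'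
  rw [← Nat.factorization_prime_le_iff_dvd (mul_ne_zero hn hC) (Nat.lcmUpto_ne_zero _)]
  intro p hp
  rw [Nat.factorization_lcmUpto _ hp, Nat.factorization_mul hn hC, Finsupp.add_apply]
  exact factorization_add_factorization_centralBinom_le_log hp hn

/-! ### Lemma "bdenominators" for `B₃`, `B₆`, `B₅` -/

/-- **CDT Lemma "bdenominators", `B₃`.** `B₃(y) = Σ_{n ≥ 1} yⁿ (n−1)!²/(2n)! = 2 arcsin(√y/2)²`
has denominator type `[1,…,2n]·n`, i.e. `[1,…,2n] · n · (n−1)!² / (2n)!` is an integer for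
every `n ≥ 1` — stated as the divisibility `(2n)! ∣ lcm(1,…,2n) · n · (n−1)!²`. (Since
`(2n)! = C(2n,n)·n²·(n−1)!²`, this is `n·C(2n,n) ∣ lcm(1,…,2n)`.)
[cite: CalegariDimitrovTang2024, §10.2 Lemma "bdenominators" (B₃), with §10.1 eq. (defB) (pp. 97–98)] -/
theorem factorial_two_mul_dvd_lcmUpto_mul {n : ℕ} (hn : n ≠ 0) :
    (2 * n)! ∣ Nat.lcmUpto (2 * n) * (n * (n - 1)! ^ 2) := by
  obtain ⟨k, hk⟩ := mul_centralBinom_dvd_lcmUpto hn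
  obtain ⟨m, rfl⟩ : ∃ m, n = m + 1 := ⟨n - 1, (Nat.succ_pred_eq_of_ne_zero hn).symm⟩
  have hC : (2 * (m + 1)).choose (m + 1) * (m + 1)! * (m + 1)! = (2 * (m + 1))! := by
    have := Nat.choose_mul_factorial_mul_factorial (n := 2 * (m + 1)) (k := m + 1) (by omega)
    rwa [show 2 * (m + 1) - (m + 1) = m + 1 by omega] at this
  refine ⟨k, ?_⟩
  rw [hk, Nat.add_sub_cancel, ← hC, Nat.factorial_succ]
  ring

/-- **CDT Lemma "bdenominators", `B₆`.** `B₆(y) = ∫ B₃(y) dy/y = Σ_{n ≥ 1} yⁿ (n−1)!²/(n (2n)!)`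
has denominator type `[1,…,2n]·n²`: `n·(2n)! ∣ lcm(1,…,2n) · n² · (n−1)!²` (`n ≥ 1`).
[cite: CalegariDimitrovTang2024, §10.2 Lemma "bdenominators" (B₆), eq. (defB67) (p. 98)] -/
theorem mul_factorial_two_mul_dvd_lcmUpto_mul {n : ℕ} (hn : n ≠ 0) :
    n * (2 * n)! ∣ Nat.lcmUpto (2 * n) * (n ^ 2 * (n - 1)! ^ 2) := by
  have h := Nat.mul_dvd_mul_left n (factorial_two_mul_dvd_lcmUpto_mul hn)
  convert h using 1
  ring

/-- **CDT Lemma "bdenominators", `B₅`.** Nielsen's function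
`B₅(y) = Σ_{n ≥ 1} yⁿ (n−1)!²/((2n−1)!(2n−1)) = y·₃F₂(½,1,1; 3/2,3/2; y/4)` has denominator type
`[1,…,2n]·(2n−1)`: `(2n−1)!·(2n−1) ∣ lcm(1,…,2n) · (2n−1) · (n−1)!²` (`n ≥ 1`), i.e.
`(2n−1)! ∣ lcm(1,…,2n)·(n−1)!²` (from the `B₃` case and `(2n)! = 2n·(2n−1)!`).
[cite: CalegariDimitrovTang2024, §10.2 Lemma "bdenominators" (B₅), §10.1 eq. (defB5) (pp. 97–98)] -/
theorem factorial_two_mul_sub_one_dvd_lcmUpto_mul {n : ℕ} (hn : n ≠ 0) :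
    (2 * n - 1)! * (2 * n - 1) ∣ Nat.lcmUpto (2 * n) * ((2 * n - 1) * (n - 1)! ^ 2) := by
  have hcore : (2 * n - 1)! ∣ Nat.lcmUpto (2 * n) * (n - 1)! ^ 2 := by
    have h := factorial_two_mul_dvd_lcmUpto_mul hn
    obtain ⟨m, rfl⟩ : ∃ m, n = m + 1 := ⟨n - 1, (Nat.succ_pred_eq_of_ne_zero hn).symm⟩
    rw [show 2 * (m + 1) - 1 = 2 * m + 1 by omega]
    rw [show 2 * (m + 1) = 2 * m + 1 + 1 by ring, Nat.factorial_succ] at h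
    -- `h : (2m+2)·(2m+1)! ∣ lcm · ((m+1) · m!²)`
    have h' : 2 * (2 * m + 1)! * (m + 1) ∣ Nat.lcmUpto (2 * m + 1 + 1) * (m + 1 - 1)! ^ 2 * (m + 1) := by
      convert h using 1 <;> ring
    have h2 := Nat.dvd_of_mul_dvd_mul_right (Nat.succ_pos m) h'
    rw [show 2 * (m + 1) = 2 * m + 1 + 1 by ring]
    exact dvd_of_mul_left_dvd h2
  have h := Nat.mul_dvd_mul_left (2 * n - 1) hcore
  convert h using 1 <;> ring

/-! ### Lemma "bdenominators" for `B₂`: `n(n−1)·C(2n,n)` divides `2·lcm(1,…,2n)` -/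

/-- If `p ∣ n − 1` (`n ≥ 2`) then `n ≡ 1 (mod p^i)` for `1 ≤ i ≤ v_p(n−1)`. [folklore] -/
theorem mod_pow_eq_one_of_dvd_sub_one {p n i : ℕ} (hp : p.Prime) (hn : 2 ≤ n) (hi : 1 ≤ i)
    (hdvd : p ^ i ∣ n - 1) : n % p ^ i = 1 := by
  have hpi : p ^ i ≠ 1 := (Nat.one_lt_pow (by omega) hp.one_lt).ne'
  conv_lhs => rw [show n = n - 1 + 1 by omega]
  rw [Nat.add_mod, Nat.mod_eq_zero_of_dvd hdvd, zero_add, Nat.mod_mod, Nat.one_mod_eq_one.mpr hpi]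

/-- **`v_p(n) + v_p(n−1) + v_p(C(2n,n)) ≤ v_p(2) + ⌊log_p 2n⌋`** for `n ≥ 2`. If `p ∤ n − 1` this
is the previous bound. If `p ∣ n − 1` then `p ∤ n`, and the `v_p(n−1)` low digits of `n` in
base `p` are `1, 0, …, 0`, so adding `n + n` carries at none of these positions when `p` is odd,
and only at the units position when `p = 2` (whence the extra `v_p(2)`). [folklore] -/
theorem factorization_mul_sub_one_mul_centralBinom_le {p n : ℕ} (hp : p.Prime) (hn : 2 ≤ n) :
    n.factorization p + (n - 1).factorization p + ((2 * n).choose n).factorization p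
      ≤ (2 : ℕ).factorization p + Nat.log p (2 * n) := by
  by_cases hdvd : p ∣ n - 1
  · -- `p ∣ n - 1`, so `p ∤ n`
    have hndvd : ¬ p ∣ n := by
      intro h
      have h1 : p ∣ n - (n - 1) := Nat.dvd_sub h hdvd
      rw [show n - (n - 1) = 1 by omega] at h1
      exact hp.one_lt.ne' (Nat.dvd_one.mp h1)
    rw [Nat.factorization_eq_zero_of_not_dvd hndvd, zero_add]
    set a := (n - 1).factorization p with ha_def
    have hpa : p ^ a ∣ n - 1 := Nat.ordProj_dvd (n - 1) p
    have haL : a ≤ Nat.log p (2 * n) := by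
      refine Nat.le_log_of_pow_le hp.one_lt ?_
      exact (Nat.le_of_dvd (by omega) hpa).trans (by omega)
    have hmod : ∀ i ∈ Finset.Icc 1 a, n % p ^ i = 1 := fun i hi =>
      mod_pow_eq_one_of_dvd_sub_one hp hn (Finset.mem_Icc.mp hi).1
        ((Nat.pow_dvd_pow p (Finset.mem_Icc.mp hi).2).trans hpa)
    have hK := factorization_centralBinom_le_card_add a hp (n := n)
    -- the carrying positions among `1 ≤ i ≤ a` are those with `p^i ≤ 2`, i.e. only `i = 1, p = 2`
    have hfilter : ((Finset.Icc 1 a).filter (fun i => p ^ i ≤ n % p ^ i + n % p ^ i)).card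
        ≤ (2 : ℕ).factorization p := by
      rw [Nat.prime_two.factorization, Finsupp.single_apply]
      by_cases hp2 : (2 : ℕ) = p
      · rw [if_pos hp2]
        subst hp2
        refine Finset.card_le_one.mpr fun i hi j hj => ?_
        rw [Finset.mem_filter] at hi hj
        have hile : i ≤ 1 := by
          by_contra h
          have h4 : 2 ^ 2 ≤ 2 ^ i := Nat.pow_le_pow_right two_pos (by omega)
          have := hi.2
          rw [hmod i hi.1] at this
          norm_num at h4
          omega
        have hjle : j ≤ 1 := by
          by_contra h
          have h4 : 2 ^ 2 ≤ 2 ^ j := Nat.pow_le_pow_right two_pos (by omega)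
          have := hj.2
          rw [hmod j hj.1] at this
          norm_num at h4
          omega
        have hi1 := (Finset.mem_Icc.mp hi.1).1
        have hj1 := (Finset.mem_Icc.mp hj.1).1
        omega
      · rw [if_neg hp2]
        have hp3 : 3 ≤ p := by have := hp.two_le; omega
        rw [Nat.le_zero, Finset.card_eq_zero, Finset.filter_eq_empty_iff]
        intro i hi hle
        rw [hmod i hi] at hle
        have : p ≤ p ^ i := Nat.le_self_pow (by have := (Finset.mem_Icc.mp hi).1; omega) p
        omega
    omega
  · rw [Nat.factorization_eq_zero_of_not_dvd hdvd, add_zero]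
    exact (factorization_add_factorization_centralBinom_le_log hp (by omega)).trans
      (Nat.le_add_left _ _)

/-- **`n(n−1)·C(2n,n)` divides `2·lcm(1,…,2n)`** (`n ≥ 2`), prime by prime from
`factorization_mul_sub_one_mul_centralBinom_le`. [folklore] -/
theorem mul_sub_one_mul_centralBinom_dvd_two_mul_lcmUpto {n : ℕ} (hn : 2 ≤ n) :
    n * (n - 1) * (2 * n).choose n ∣ 2 * Nat.lcmUpto (2 * n) := by
  have hC : (2 * n).choose n ≠ 0 := (Nat.choose_pos (by omega)).ne'
  have hn0 : n ≠ 0 := by omega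
  have hn1 : n - 1 ≠ 0 := by omega
  rw [← Nat.factorization_prime_le_iff_dvd (mul_ne_zero (mul_ne_zero hn0 hn1) hC)
    (mul_ne_zero two_ne_zero (Nat.lcmUpto_ne_zero _))]
  intro p hp
  rw [Nat.factorization_mul (mul_ne_zero hn0 hn1) hC, Nat.factorization_mul hn0 hn1,
    Nat.factorization_mul two_ne_zero (Nat.lcmUpto_ne_zero _), Finsupp.add_apply,
    Finsupp.add_apply, Finsupp.add_apply, Nat.factorization_lcmUpto _ hp]
  exact factorization_mul_sub_one_mul_centralBinom_le hp hn

/-- **CDT Lemma "bdenominators", `B₂`.**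
`B₂(y) = Σ_{n ≥ 2} 2yⁿ (n−2)! n!/(2n)! = 2y − 2√(y(4−y)) arcsin(√y/2)` has denominator type
`[1,…,2n]`: `(2n)! ∣ lcm(1,…,2n) · 2 · (n−2)! · n!` for every `n ≥ 2` (equivalently
`n(n−1)C(2n,n) ∣ 2·lcm(1,…,2n)`; the factor `2` of the coefficient is needed exactly at `p = 2`).
[cite: CalegariDimitrovTang2024, §10.2 Lemma "bdenominators" (B₂), §10.1 eq. (defB) (pp. 97–98)] -/
theorem factorial_two_mul_dvd_lcmUpto_mul_two_mul {n : ℕ} (hn : 2 ≤ n) :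
    (2 * n)! ∣ Nat.lcmUpto (2 * n) * (2 * (n - 2)! * n !) := by
  obtain ⟨k, hk⟩ := mul_sub_one_mul_centralBinom_dvd_two_mul_lcmUpto hn
  obtain ⟨m, rfl⟩ : ∃ m, n = m + 2 := ⟨n - 2, by omega⟩
  have hC : (2 * (m + 2)).choose (m + 2) * (m + 2)! * (m + 2)! = (2 * (m + 2))! := by
    have := Nat.choose_mul_factorial_mul_factorial (n := 2 * (m + 2)) (k := m + 2) (by omega)
    rwa [show 2 * (m + 2) - (m + 2) = m + 2 by omega] at this
  have hf1 : (m + 1)! = (m + 1) * m ! := Nat.factorial_succ m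
  have hf2 : (m + 2)! = (m + 2) * (m + 1)! := Nat.factorial_succ (m + 1)
  rw [show m + 2 - 1 = m + 1 by omega] at hk
  refine ⟨k, ?_⟩
  rw [show m + 2 - 2 = m by omega, ← hC]
  have e : Nat.lcmUpto (2 * (m + 2)) * (2 * m ! * (m + 2)!)
      = (2 * Nat.lcmUpto (2 * (m + 2))) * (m ! * (m + 2)!) := by ring
  rw [e, hk, hf2, hf1]
  ring

end CalegariDimitrovTang

end Literature.NumberTheory.Transcendental
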